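import Literature.MathematicalPhysics.QuantumLattice.InfVolFermionStateWeakLimits
import HarnessLib

/-!
# The density is weak-⋆ continuous, the translation-invariant density-`n` class is weak-⋆ closed, and
# mean-energy MINIMISERS AT FIXED DENSITY exist (canonical-class ground states in infinite volume)

Topic `Literature/MathematicalPhysics/QuantumLattice`; namespace
`Literature.MathematicalPhysics.QuantumLattice` (the file path). Companion of
`InfVolFermionStateWeakLimits.lean` (sequential Banach–Alaoglu `exists_tendsto_expect_subseq`;
translation invariance closed; the mean energy continuous; UNCONSTRAINED translation-invariant minimisers
exist, `FermionInteraction.exists_isMeanEnergyMinimiser`). Here the same argument is run INSIDE the class of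
translation-invariant states of particle density EXACTLY `n` — the «canonical class» of the Hubbard
cuprate cell's pinning-field chord floor (`Summits/Ventures/CertifiedManyBodySolver/Observables/
TISourcedMinimiserChordFloor.lean`, which so far speaks of ε-minimisers only): the density
`ω.density = Re ω(n_{0↑} + n_{0↓})` is the real part of the expectation of ONE local observable, hence
weak-⋆ continuous, so the class is closed and a minimising sequence has a convergent subsequence inside it.

* `InfVolFermionState.tendsto_density_of_tendsto_expect` — pointwise convergence of the local expectations
  implies convergence of the densities; `density_eq_of_tendsto_expect` — a limit of density-`n` states has
  density `n`.
* `InfVolFermionState.exists_meanEnergy_minimiser_densityClass` — for every finite-range interaction `Ψ`,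
  range parameter `R` and density `n` whose translation-invariant class is nonempty, there is a
  translation-invariant `ω` of density `n` with `e_Ψ(ω) ≤ e_Ψ(ω')` for every translation-invariant `ω'` of
  density `n` (Bratteli–Robinson I Thm. 2.3.15 compactness + Ruelle 1969 §3.4: the ground-state energy density
  at fixed density as an infimum of the mean energy; the infimum is attained).
* `InfVolFermionState.exists_meanEnergy_minimiser_densityClass_le_add` — the minimiser is in particular an
  ε-minimiser for every `ε ≥ 0` (the hypothesis shape `hmin` of the chord-floor consumers).

Everything is PROVED; no definition, no named fact, zero compute.

## References
* O. Bratteli, D. W. Robinson, *Operator Algebras and Quantum Statistical Mechanics 1*, 2nd ed. (1987),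
  Thm. 2.3.15 (weak-⋆ compactness of the state space), §4.3.1 (invariant states).
  [cite: BratteliRobinsonI1987, Thm. 2.3.15]
* D. Ruelle, *Statistical Mechanics* (1969), §3.4 (the ground-state energy density at fixed density as the
  infimum of the mean energy over invariant states). [cite: Ruelle1969, §3.4]
* H. Araki, H. Moriya, Rev. Math. Phys. 15 (2003) 93, §4.1 (densities of fermion lattice states).
  [cite: ArakiMoriya2003, §4.1]
-/

noncomputable section

namespace Literature.MathematicalPhysics.QuantumLattice

open Matrix Finset HubbardWave0 _root_.Filter Literature.Probability.LatticeModels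
open scoped _root_.Topology ComplexOrder Matrix.Norms.L2Operator

variable {d : ℕ}

namespace InfVolFermionState

section Closed

variable {ω : ℕ → InfVolFermionState d} {ωl : InfVolFermionState d}

/-- **The density is weak-⋆ continuous**: if `ω_{j,Λ}(A) → ωl_Λ(A)` for all `Λ, A`, then
`ρ(ω_j) → ρ(ωl)` (`ρ = Re ω(n_{0↑} + n_{0↓})` is the real part of ONE local expectation).
[cite: ArakiMoriya2003, §4.1] -/
theorem tendsto_density_of_tendsto_expect
    (hlim : ∀ (Λ : Finset (Site d)) (A : FermionOp Λ),
      Tendsto (fun j => (ω j).expect Λ A) atTop (𝓝 (ωl.expect Λ A))) :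
    Tendsto (fun j => (ω j).density) atTop (𝓝 ωl.density) := by
  unfold density densityAt
  exact (Complex.continuous_re.tendsto _).comp (hlim _ _)

/-- **The density-`n` class is weak-⋆ closed**: a pointwise limit of states of density `n` has density `n`.
[cite: ArakiMoriya2003, §4.1] -/
theorem density_eq_of_tendsto_expect
    (hlim : ∀ (Λ : Finset (Site d)) (A : FermionOp Λ),
      Tendsto (fun j => (ω j).expect Λ A) atTop (𝓝 (ωl.expect Λ A)))
    {n : ℝ} (hn : ∀ j, (ω j).density = n) : ωl.density = n :=
  tendsto_nhds_unique (tendsto_density_of_tendsto_expect hlim) (tendsto_const_nhds.congr fun j => (hn j).symm)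

end Closed

section Minimiser

/-- **Mean-energy minimisers at fixed density exist.** For every finite-range interaction `Ψ`, range
parameter `R`, and density `n` such that SOME translation-invariant state has density `n`, there is a
translation-invariant state `ω` of density `n` minimising `e_Ψ` over all translation-invariant states of
density `n`. (A minimising sequence — `e_Ψ` is bounded below by `−‖E_Ψ‖` — has a weak-⋆ convergent
subsequence; translation invariance and the density pass to the limit and `e_Ψ` is continuous.)
[cite: BratteliRobinsonI1987, Thm. 2.3.15] [cite: Ruelle1969, §3.4] -/
theorem exists_meanEnergy_minimiser_densityClass (Ψ : FermionInteraction d) (R : ℝ) {n : ℝ}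
    (hne : ∃ σ : InfVolFermionState d, σ.IsTranslationInvariant ∧ σ.density = n) :
    ∃ ω : InfVolFermionState d, ω.IsTranslationInvariant ∧ ω.density = n ∧
      ∀ ω' : InfVolFermionState d, ω'.IsTranslationInvariant → ω'.density = n →
        ω.meanEnergy Ψ R ≤ ω'.meanEnergy Ψ R := by
  classical
  set S : Set ℝ := (fun σ : InfVolFermionState d => σ.meanEnergy Ψ R) ''
    {σ | σ.IsTranslationInvariant ∧ σ.density = n} with hS
  have hSne : S.Nonempty := by
    obtain ⟨σ, hσ, hσn⟩ := hne
    exact ⟨_, σ, ⟨hσ, hσn⟩, rfl⟩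
  have hSbdd : BddBelow S := by
    refine ⟨-‖Ψ.meanEnergyObs R‖, ?_⟩
    rintro _ ⟨σ, -, rfl⟩
    exact (abs_le.1 (σ.abs_meanEnergy_le_norm Ψ R)).1
  -- a minimising sequence inside the class
  have hseq : ∀ j : ℕ, ∃ σ : InfVolFermionState d, σ.IsTranslationInvariant ∧ σ.density = n ∧
      σ.meanEnergy Ψ R < sInf S + 1 / ((j : ℝ) + 1) := by
    intro j
    obtain ⟨x, ⟨σ, ⟨hσ, hσn⟩, rfl⟩, hlt⟩ :=
      Real.lt_sInf_add_pos hSne (show (0 : ℝ) < 1 / ((j : ℝ) + 1) by positivity)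
    exact ⟨σ, hσ, hσn, hlt⟩
  choose σ hTI hρ hlt using hseq
  obtain ⟨φ, hφ, ωl, hlim⟩ := exists_tendsto_expect_subseq σ
  refine ⟨ωl, isTranslationInvariant_of_tendsto_expect hlim fun j => hTI (φ j),
    density_eq_of_tendsto_expect hlim fun j => hρ (φ j), fun ω' hω' hω'n => ?_⟩
  have hle : sInf S ≤ ω'.meanEnergy Ψ R := csInf_le hSbdd ⟨ω', ⟨hω', hω'n⟩, rfl⟩
  have hup : Tendsto (fun j => sInf S + 1 / (((φ j : ℕ) : ℝ) + 1)) atTop (𝓝 (sInf S)) := by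
    have h0 : Tendsto (fun j => 1 / (((φ j : ℕ) : ℝ) + 1)) atTop (𝓝 0) :=
      tendsto_one_div_add_atTop_nhds_zero_nat.comp hφ.tendsto_atTop
    simpa using (tendsto_const_nhds (x := sInf S)).add h0
  have hωl : ωl.meanEnergy Ψ R ≤ sInf S :=
    le_of_tendsto_of_tendsto' (tendsto_meanEnergy_of_tendsto_expect hlim Ψ R) hup fun j => (hlt (φ j)).le
  exact hωl.trans hle

/-- **A minimiser at fixed density is an ε-minimiser for every `ε ≥ 0`** (the hypothesis shape `hmin` of the
chord-floor consumers, with `ε = 0` allowed). [cite: Ruelle1969, §3.4] -/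
theorem exists_meanEnergy_minimiser_densityClass_le_add (Ψ : FermionInteraction d) (R : ℝ) {n ε : ℝ}
    (hne : ∃ σ : InfVolFermionState d, σ.IsTranslationInvariant ∧ σ.density = n) (hε : 0 ≤ ε) :
    ∃ ω : InfVolFermionState d, ω.IsTranslationInvariant ∧ ω.density = n ∧
      ∀ ω' : InfVolFermionState d, ω'.IsTranslationInvariant → ω'.density = n →
        ω.meanEnergy Ψ R ≤ ω'.meanEnergy Ψ R + ε := by
  obtain ⟨ω, hω, hωn, hmin⟩ := exists_meanEnergy_minimiser_densityClass Ψ R hne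
  exact ⟨ω, hω, hωn, fun ω' hω' hω'n => (hmin ω' hω' hω'n).trans (le_add_of_nonneg_right hε)⟩

end Minimiser

end InfVolFermionState

end Literature.MathematicalPhysics.QuantumLattice

end
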